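import Mathlib
import Literature.MathematicalPhysics.QuantumFieldTheory.YangMillsOS
import Literature.MathematicalPhysics.QuantumFieldTheory.SpeciesLatticeProducts
import Literature.MathematicalPhysics.QuantumFieldTheory.LatticeGaugeProofs
import Literature.MathematicalPhysics.QuantumLattice.WilsonFeynmanHellmann
import Summits.QuantumFields.YangMills.Theorems.MirrorModularBoostsHypercubicLimitTypedResponseVacuous
import HarnessLib

/-!
# Line `Sketch` (holomorphic coupling response) of crux `HypercubicLimit` — reshape 1:
# the coupling response is smooth on the real axis

Support file for crux `stmt-QuantumFields-16154` (`CoincidenceRotationBootstrap.HypercubicLimit` =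
`MirrorModularBoosts.WeakCouplingHypercubicLimit`), line `Sketch` (card `holomorphic-coupling-response`,
reshape 1), registered stub `stub_responseSmooth`.

With `μ_k = wilsonMeasure r.ρ (sch.β k)` the Wilson measure of the scheme at step `k` (a probability
measure on the compact configuration space `GaugeConfig 4 (sch.side k) G`) and
`Φ_k(f) U = smearedLatticeField r.curvature.F (box 4 L_k) a_k c_k m_k f (torusLift (sch.side k) U)` the
smeared renormalised curvature field (a bounded measurable observable), the tilt of `μ_k` by `t Φ_k(f₁)`
is Wilson's theory with locally modulated coupling and `g(t) = ∫ Φ_k(f₀) d(μ_k.tilted (t Φ_k(f₁)))` is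
its one-point function.  This file records that `g` is `C^∞` on `ℝ`.

Proof: `g = N / Z` with `N(t) = ∫ Φ_k(f₀) e^{t Φ_k(f₁)} dμ_k` and `Z(t) = ∫ e^{t Φ_k(f₁)} dμ_k > 0`
(`integral_tilted_eq_integral_mul_exp_div_mgf`).  For bounded measurable `F`, `Y` on a finite measure
space, `s ↦ ∫ F e^{sY} dμ` is differentiable with derivative `s ↦ ∫ (F Y) e^{sY} dμ` — a function of
the same shape with the bounded observable `F Y` (`hasDerivAt_integral_mul_exp_mul`, differentiation
under the integral sign) — so by induction on `n` every such function is `Cⁿ`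
(`contDiff_succ_iff_deriv`), hence `C^∞`; the quotient of two `C^∞` functions with non-vanishing
denominator is `C^∞`.

* `responseSmooth_hasDerivAt_integral_mul_exp`, `responseSmooth_contDiff_integral_mul_exp` — the
  weighted Laplace transforms `s ↦ ∫ F e^{sY} dμ` and their smoothness;
* `responseSmooth_contDiff_integral_tilted` — the abstract statement: tilted expectations of bounded
  observables are smooth in the tilting parameter;
* `stub_responseSmooth` — the registered stub (tree vocabulary).
-/

noncomputable section

open scoped SchwartzMap
open MeasureTheory ProbabilityTheory Filter Topology
open Literature.MathematicalPhysics.QuantumLattice Literature.MathematicalPhysics.QuantumFieldTheory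

namespace Summit.QuantumFields.YangMills.Cruxes.HypercubicLimit.CouplingResponse

section Abstract

variable {Ω : Type*} {mΩ : MeasurableSpace Ω} {μ : Measure Ω} [IsFiniteMeasure μ] {X Y : Ω → ℝ}

/-- **Differentiation of a weighted Laplace transform.**  For bounded measurable `F`, `Y` on a finite
measure space and every real `t`, `d/ds ∫ F e^{sY} dμ |_{s=t} = ∫ (F Y) e^{tY} dμ` (differentiation under
the integral sign, `hasDerivAt_integral_mul_exp_mul`; the integrability interval of `e^{sY}` is all of
`ℝ` since `Y` is bounded).  Standard analyticity bookkeeping for Gibbs reweightings (B. Simon, The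
Statistical Mechanics of Lattice Gases I, Princeton 1993, §II.1). [folklore] -/
theorem responseSmooth_hasDerivAt_integral_mul_exp (hY : Measurable Y) {CY : ℝ}
    (hbY : ∀ ω, |Y ω| ≤ CY) {F : Ω → ℝ} (hF : Measurable F) {C : ℝ} (hC : ∀ ω, |F ω| ≤ C)
    (t : ℝ) :
    HasDerivAt (fun s => ∫ ω, F ω * Real.exp (s * Y ω) ∂μ)
      (∫ ω, F ω * Y ω * Real.exp (t * Y ω) ∂μ) t := by
  have hset : integrableExpSet Y μ = Set.univ :=
    integrableExpSet_eq_univ_of_abs_le hY.aemeasurable (ae_of_all _ hbY)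
  have ht : t ∈ interior (integrableExpSet Y μ) := by rw [hset, interior_univ]; trivial
  have h := hasDerivAt_integral_mul_exp_mul (μ := μ) (X := Y) (F := F) (C := C) ht
    hF.aestronglyMeasurable (ae_of_all _ fun ω => by rw [Real.norm_eq_abs]; exact hC ω)
  refine h.congr_deriv (integral_congr_ae (ae_of_all _ fun ω => ?_))
  ring

/-- **Weighted Laplace transforms of bounded observables are `Cⁿ`.**  For bounded measurable `Y` on a
finite measure space and every `n : ℕ`, every function `s ↦ ∫ F e^{sY} dμ` with `F` bounded measurable
is `Cⁿ` on `ℝ`: its derivative is the function of the same shape with weight `F Y`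
(`responseSmooth_hasDerivAt_integral_mul_exp`), so the claim follows by induction on `n`
(`contDiff_succ_iff_deriv`).  Standard analyticity bookkeeping for Gibbs reweightings (B. Simon, The
Statistical Mechanics of Lattice Gases I, Princeton 1993, §II.1). [folklore] -/
theorem responseSmooth_contDiff_integral_mul_exp (hY : Measurable Y) {CY : ℝ}
    (hbY : ∀ ω, |Y ω| ≤ CY) (n : ℕ) :
    ∀ (F : Ω → ℝ), Measurable F → ∀ C : ℝ, (∀ ω, |F ω| ≤ C) →
      ContDiff ℝ n (fun s => ∫ ω, F ω * Real.exp (s * Y ω) ∂μ) := by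
  induction n with
  | zero =>
    intro F hF C hC
    rw [Nat.cast_zero, contDiff_zero]
    exact continuous_iff_continuousAt.2 fun t =>
      (responseSmooth_hasDerivAt_integral_mul_exp hY hbY hF hC t).continuousAt
  | succ n ih =>
    intro F hF C hC
    rw [Nat.cast_succ, contDiff_succ_iff_deriv]
    refine ⟨fun t => (responseSmooth_hasDerivAt_integral_mul_exp hY hbY hF hC t).differentiableAt,
      fun h => absurd h (by simp), ?_⟩
    have hd : deriv (fun s => ∫ ω, F ω * Real.exp (s * Y ω) ∂μ) =
        fun s => ∫ ω, F ω * Y ω * Real.exp (s * Y ω) ∂μ :=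
      funext fun t => (responseSmooth_hasDerivAt_integral_mul_exp hY hbY hF hC t).deriv
    rw [hd]
    refine ih (fun ω => F ω * Y ω) (hF.mul hY) (C * CY) fun ω => ?_
    rw [abs_mul]
    exact mul_le_mul (hC ω) (hbY ω) (abs_nonneg _) ((abs_nonneg _).trans (hC ω))

/-- **Tilted expectations of bounded observables are smooth in the tilting parameter.**  For bounded
measurable `X`, `Y` on a finite measure space, `t ↦ ∫ X d(μ.tilted (tY))` is `C^∞` on `ℝ`: it is the
quotient `(∫ X e^{tY} dμ) / (∫ e^{tY} dμ)` (`integral_tilted_eq_integral_mul_exp_div_mgf`) of two `C^∞`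
functions (`responseSmooth_contDiff_integral_mul_exp`) with positive denominator (for `μ = 0` it is the
zero constant).  Standard analyticity bookkeeping for Gibbs reweightings (B. Simon, The Statistical
Mechanics of Lattice Gases I, Princeton 1993, §II.1). [folklore] -/
theorem responseSmooth_contDiff_integral_tilted (hX : Measurable X) (hY : Measurable Y)
    {CX CY : ℝ} (hbX : ∀ ω, |X ω| ≤ CX) (hbY : ∀ ω, |Y ω| ≤ CY) :
    ContDiff ℝ (⊤ : ℕ∞) (fun t : ℝ => ∫ ω, X ω ∂(μ.tilted (t * Y ·))) := by
  rcases eq_zero_or_neZero μ with rfl | hμ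
  · simp only [tilted_zero_measure, integral_zero_measure]
    exact contDiff_const
  have hZ : ∀ t : ℝ, mgf Y μ t = ∫ ω, (fun _ : Ω => (1 : ℝ)) ω * Real.exp (t * Y ω) ∂μ := by
    intro t
    simp only [mgf, one_mul]
  have hfun : (fun t : ℝ => ∫ ω, X ω ∂(μ.tilted (t * Y ·))) =
      fun t => (∫ ω, X ω * Real.exp (t * Y ω) ∂μ) /
        ∫ ω, (fun _ : Ω => (1 : ℝ)) ω * Real.exp (t * Y ω) ∂μ := by
    funext t
    rw [integral_tilted_eq_integral_mul_exp_div_mgf, hZ]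
  rw [hfun]
  have hZne : ∀ t : ℝ, (∫ ω, (fun _ : Ω => (1 : ℝ)) ω * Real.exp (t * Y ω) ∂μ) ≠ 0 := by
    intro t
    have hint : Integrable (fun ω => Real.exp (t * Y ω)) μ := by
      have hset : integrableExpSet Y μ = Set.univ :=
        integrableExpSet_eq_univ_of_abs_le hY.aemeasurable (ae_of_all _ hbY)
      have hmem : t ∈ integrableExpSet Y μ := by rw [hset]; trivial
      exact hmem
    rw [← hZ]
    exact (mgf_pos' hμ.out hint).ne'
  exact contDiff_infty.2 fun n =>
    (responseSmooth_contDiff_integral_mul_exp hY hbY n X hX CX hbX).div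
      (responseSmooth_contDiff_integral_mul_exp hY hbY n (fun _ => (1 : ℝ)) measurable_const 1
        fun _ => by simp) hZne

end Abstract

/-! ### The registered stub -/

/-- **Stub `stub_responseSmooth` of line `Sketch` (reshape 1) — the coupling response is smooth.**
For the step-`k` Wilson measure `μ_k = wilsonMeasure r.ρ (sch.β k)` (a probability measure on the
compact configuration space) and the smeared renormalised curvature fields `Φ_k(f₀)`, `Φ_k(f₁)` (bounded
measurable observables), the one-point function `g(t) = ∫ Φ_k(f₀) d(μ_k.tilted (t Φ_k(f₁)))` of Wilson's
theory with coupling modulated by `t f₁` is `C^∞` in `t ∈ ℝ`: `g = N/Z` with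
`N(t) = ∫ Φ_k(f₀) e^{t Φ_k(f₁)} dμ_k`, `Z(t) = ∫ e^{t Φ_k(f₁)} dμ_k > 0` both smooth by repeated
differentiation under the integral sign (`responseSmooth_contDiff_integral_tilted`).  Standard
analyticity bookkeeping for Gibbs reweightings (B. Simon, The Statistical Mechanics of Lattice Gases I,
Princeton 1993, §II.1; lattice gauge setting E. Seiler, LNP 159 (1982), Ch. 1–2). [folklore] -/
theorem stub_responseSmooth :
    ∀ (G : Type) [Group G] [TopologicalSpace G] [IsTopologicalGroup G] [CompactSpace G]
      [MeasurableSpace G] [BorelSpace G] (r : LatticeRep G) (sch : SpeciesScheme (YMSpecies G))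
      (k : ℕ) (f₀ f₁ : 𝓢(EuclideanSpace ℝ (Fin 4), ℝ)),
      ContDiff ℝ (⊤ : ℕ∞) (fun t : ℝ => ∫ U, smearedLatticeField r.curvature.F
        (Literature.Probability.LatticeModels.box 4 (sch.L k)) (sch.a k) (sch.c r.curvature k)
        (sch.m r.curvature k) f₀ (torusLift (sch.side k) U)
        ∂((wilsonMeasure r.ρ (sch.β k) : Measure (GaugeConfig 4 (sch.side k) G)).tilted
          (fun U => t * smearedLatticeField r.curvature.F
            (Literature.Probability.LatticeModels.box 4 (sch.L k)) (sch.a k) (sch.c r.curvature k)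
            (sch.m r.curvature k) f₁ (torusLift (sch.side k) U)))) := by
  intro G _ _ _ _ _ _ r sch k f₀ f₁
  haveI : IsProbabilityMeasure
      (wilsonMeasure r.ρ (sch.β k) : Measure (GaugeConfig 4 (sch.side k) G)) :=
    isProbabilityMeasure_wilsonMeasure (d := 4) (L := sch.side k) r.ρ r.continuous (sch.β k)
  have hXm : Measurable fun U : GaugeConfig 4 (sch.side k) G => smearedLatticeField r.curvature.F
      (Literature.Probability.LatticeModels.box 4 (sch.L k)) (sch.a k) (sch.c r.curvature k)
      (sch.m r.curvature k) f₀ (torusLift (sch.side k) U) :=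
    measurable_smearedLatticeField_torusLift r.curvature _ _ _ _ f₀ _
  have hYm : Measurable fun U : GaugeConfig 4 (sch.side k) G => smearedLatticeField r.curvature.F
      (Literature.Probability.LatticeModels.box 4 (sch.L k)) (sch.a k) (sch.c r.curvature k)
      (sch.m r.curvature k) f₁ (torusLift (sch.side k) U) :=
    measurable_smearedLatticeField_torusLift r.curvature _ _ _ _ f₁ _
  obtain ⟨CX, hCX⟩ := exists_bound_smearedLatticeField r.curvature.bounded
    (Literature.Probability.LatticeModels.box 4 (sch.L k)) (sch.a k) (sch.c r.curvature k)
    (sch.m r.curvature k) f₀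
  obtain ⟨CY, hCY⟩ := exists_bound_smearedLatticeField r.curvature.bounded
    (Literature.Probability.LatticeModels.box 4 (sch.L k)) (sch.a k) (sch.c r.curvature k)
    (sch.m r.curvature k) f₁
  exact responseSmooth_contDiff_integral_tilted hXm hYm (fun U => hCX _) (fun U => hCY _)

end Summit.QuantumFields.YangMills.Cruxes.HypercubicLimit.CouplingResponse

end
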